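import Summits.HodgeConjecture.HodgeConjecture.Theorems.LinearSystemTorelliTranscendentalOrSupportedStubCorrTail
import Summits.HodgeConjecture.HodgeConjecture.Theorems.LinearSystemTorelliTranscendentalOrSupportedStubCorrDiagonal
import Summits.HodgeConjecture.HodgeConjecture.Theorems.LinearSystemTorelliTranscendentalOrSupportedStubCorrActionType
import Summits.HodgeConjecture.HodgeConjecture.Theorems.LinearSystemTorelliTranscendentalOrSupportedStubCorrActionRat
import Summits.HodgeConjecture.HodgeConjecture.Theorems.LinearSystemTorelliTranscendentalOrSupportedStubImagePhantom
import Summits.HodgeConjecture.HodgeConjecture.Theorems.LinearSystemTorelliTranscendentalOrSupportedStubIsotypicAlg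
import Summits.HodgeConjecture.HodgeConjecture.Theorems.LinearSystemTorelliSupportedOfTranscendentalOrSupported

/-!
# Crux `TranscendentalOrSupported` (stmt-HodgeConjecture-10853), line `Sketch_chow_shadow` — the ASSEMBLY:
# the crux from a cohomological transcendental decomposition of the diagonal

Helper file for the line skeleton `Cruxes/TranscendentalOrSupported/Lines/Sketch_chow_shadow.lean` of
the crux `TranscendentalOrSupported` of route `LinearSystemTorelli` — GHC(2p, coniveau 1) in
Grothendieck's corrected sub-Hodge form: for `X` smooth projective of dimension `2p` (`p ≥ 1`), a
Hodge model `A`, rational classes `b j ∈ H²ᵖ(X(ℂ); ℂ)` whose pulled-back span `W` is a sub-Hodge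
structure with `W ⊓ H^{2p,0} = ⊥`, every `b j` lies in `N¹ H²ᵖ = supportedClasses X (2p) 1`.

This file LANDS THE LINE'S REDUCTION as a sorry-free theorem (registered assembly stub
`stub_transcendentalOrSupported_of_cohTDD`): `CohTDD → TranscendentalOrSupported`, where `CohTDD`
(hypothesis `hTDD`, spelled out = the skeleton's open stub `stub_cohTDD` verbatim) is the
**cohomological transcendental decomposition of the diagonal**: for every smooth projective `X` of
dimension `2p` and Hodge model `A` there are an orientation family `μ`, a RATIONAL ALGEBRAIC class
`γ ∈ H^{4p}((X ⊗ X)(ℂ); ℂ)`, a scalar `t` and a Zariski-closed `T ⊆ X` all of whose points have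
codimension `≥ 1`, such that (i) `δ_X − t•γ` restricts to `0` on `((X ∖ T) × X)(ℂ)`, `δ_X = Δ_* 1`
the Gysin image of `1` under the diagonal, and (ii) `im γ^* ⊆ T(X) + Algᵖ(X)` on `H²ᵖ(X(ℂ); ℂ)` —
spelled without naming the transcendental part `T(X)`: `im γ^*` lies in every rationally spanned
sub-Hodge `V` containing `H^{2p,0}` and `algebraicClasses X p`. Here `γ^* = corrAction μ hX hX _ γ`,
`c ↦ pr_{1*}(pr_2^* c ∪ γ)`, is the tree's real correspondence action (first factor receives).

WHY THIS IS THE CARD'S LEVER (chow-shadow-bloch-srinivas). If a codimension-`2p` cycle `Γ` on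
`X × X` acts as the identity on `CH₀(X)_ℚ`, the Bloch–Srinivas lemma (Voisin II, Thm. 10.19 with
`X' = ∅`) gives `m(Δ_X − Γ) ≡ Z'` rationally, `Z'` supported on `T × X` for a proper closed `T`; with
Lemma 9.18 and the support of cycle classes this is (i) for `γ = [Γ]`, `t = 1/m` (up to the
orientation constant). (ii) is the requirement that `Γ` carry only the transcendental cohomology
modulo algebraic classes ("transcendental decomposition of the diagonal"); on a K3 square `S × S` it
is realised by the projector onto `Sym²₀ H²_tr(S)`, and the `CH₀`-identity is Voisin's 1996 conjecture
(inv2) (Laterveer 2016, Conj. 1; 2019, Cor. 2.7). `CohTDD` at `X` implies the crux at `X` (this file)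
and the route item `MiddleDivisorSupport` at `X` (same argument on Hodge classes); it is open ∀X.

PROOF of the reduction: `b j = (δ_X − t•γ)^*(b j) + t • γ^*(b j)` since `δ_X^* = Id`
(`stub_corrDiagonal`, Voisin I §11.3.3) and `corrAction` is linear in the class; the first summand
lies in `N¹` because `δ_X − t•γ` dies off `pr_1⁻¹ T` (`stub_corrTail`, Voisin II (10.8)); `γ^*` has
Hodge bidegree `(0,0)` (`stub_corrActionType`) and is rational up to one scalar (`stub_corrActionRat`),
so it maps `W` to a rationally spanned sub-Hodge `γ^*(W)` without `(2p,0)`-part (`stub_imagePhantom`),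
which by the isotypic lemma (`stub_isotypicAlg`: semisimplicity, `stub_completelyReducible` +
polarizability) and (ii) lies in `Algᵖ(X) = Nᵖ H²ᵖ ≤ N¹ H²ᵖ` (`supportedClasses_mono`, `p ≥ 1`).

References: S. Bloch, V. Srinivas, Amer. J. Math. 105 (1983); C. Voisin, *Hodge Theory and Complex
Algebraic Geometry II* (2003) Thm. 10.19, (10.8), Lemma 9.18; *I* (2002) §7.3, §11.3.3; C. Voisin,
in: Moduli of Vector Bundles (Taniguchi 1994), Dekker 1996 (conjecture (inv2)); R. Laterveer,
Boll. UMI 9 (2016) 435–452, Conj. 1; Rend. Circ. Mat. Palermo 68 (2019) 419–431, Cor. 2.7.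
-/

-- `Summit.HodgeConjecture.HodgeConjecture.Theorems` is the mandated namespace (single-conjunct summit:
-- Sub = Summit), which `linter.dupNamespace` flags; the lakefile turns the linter off tree-wide.
set_option linter.dupNamespace false

noncomputable section

namespace Summit.HodgeConjecture.HodgeConjecture.Theorems

open CategoryTheory MonoidalCategory CartesianMonoidalCategory
open Literature.AlgebraicGeometry.Motives Literature.AlgebraicGeometry.HodgeTheory
open Literature.AlgebraicTopology.SingularHomology

/-- The span of finitely many rational classes is spanned by its rational classes (copy of
`isotypic_span_isRationalClass_inter_eq`, kept local to spare the import of the `Sketch` assembly). -/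
theorem ofCohTDD_span_isRationalClass_inter_span_eq {X : SchemeOver ℂ} {k r : ℕ}
    {b : Fin r → complexBetti X k} (hb : ∀ j, IsRationalClass (b j)) :
    Submodule.span ℂ {x : complexBetti X k | x ∈ Submodule.span ℂ (Set.range b) ∧ IsRationalClass x} =
      Submodule.span ℂ (Set.range b) := by
  refine le_antisymm (Submodule.span_le.2 fun x hx ↦ hx.1) (Submodule.span_mono ?_)
  rintro _ ⟨j, rfl⟩
  exact ⟨Submodule.subset_span ⟨j, rfl⟩, hb j⟩

/-- **The reduction AT ONE VARIETY** (the reusable form, for instance-provers): let `X` be smooth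
projective of dimension `2p` (`p ≥ 1`) with Hodge model `A`, and suppose given the data of a
cohomological transcendental decomposition of the diagonal AT `X` — an orientation family `μ`, a
rational algebraic `γ ∈ H^{4p}((X ⊗ X)(ℂ); ℂ)`, a scalar `t`, a closed `T ⊆ X` of codimension `≥ 1`
with `δ_X − t•γ` dying on `((X ∖ T) × X)(ℂ)`, and `im γ^* ⊆ T(X) + Algᵖ(X)` (definition-free
spelling). Then every rational class `b j` whose span pulls back to a sub-Hodge structure of `A`
without `(2p,0)`-part lies in `N¹ H²ᵖ(X)`. Proof: `b j = (δ_X − t•γ)^*(b j) + t • γ^*(b j)`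
(`stub_corrDiagonal`); the first summand lies in `N¹` (`stub_corrTail`); `γ^*(W) ⊆ Algᵖ(X) ⊆ N¹` for
the span `W` of the `b j` (`stub_corrActionType`, `stub_corrActionRat`, `stub_imagePhantom`,
`stub_isotypicAlg`, `supportedClasses_mono`). -/
theorem transcendentalOrSupportedAt_of_cohTDDAt {p : ℕ} {X : SchemeOver ℂ} (hp : 1 ≤ p)
    (hX : IsSmoothProjective (2 * p) X) (A : HodgeModel (2 * p) X) {r : ℕ}
    {b : Fin r → complexBetti X (2 * p)} (hb : ∀ j, IsRationalClass (b j))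
    (hsub : (Submodule.span ℂ (Set.range b)).map (A.pullback (2 * p)).hom =
      ⨆ (p' : ℕ) (q' : ℕ) (_ : p' + q' = 2 * p),
        (Submodule.span ℂ (Set.range b)).map (A.pullback (2 * p)).hom ⊓ A.hodgePQ (2 * p) p' q')
    (h20 : (Submodule.span ℂ (Set.range b)).map (A.pullback (2 * p)).hom ⊓ A.hodgePQ (2 * p) (2 * p) 0 = ⊥)
    (μ : OrientationFamily) {γ : complexBetti (X ⊗ X) (2 * (2 * p))} (t : ℂ) {T : Set X.left}
    (hγrat : IsRationalClass γ) (hγalg : γ ∈ algebraicClasses (X ⊗ X) (2 * p)) (hT : IsClosed T)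
    (hT1 : ∀ z ∈ T, (1 : ℕ∞) ≤ Order.coheight z)
    (hδ : 0 + 2 * (2 * p + 2 * p) = 2 * (2 * p) + 2 * (2 * p))
    (hab : 2 * p + 2 * (2 * p) = 2 * p + 2 * (2 * p))
    (hsupp : complexBetti.restrictCompl (X ⊗ X) ((fst X X).left.base ⁻¹' T) (2 * (2 * p))
      (complexGysin μ hX (IsSmoothProjective.tensor_holds hX hX) (lift (𝟙 X) (𝟙 X)) hδ
        (singularCohomology.one ℂ (ComplexPoints X)) - t • γ) = 0)
    (hrange : ∀ V : Submodule ℂ (complexBetti X (2 * p)),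
      Submodule.span ℂ {x : complexBetti X (2 * p) | x ∈ V ∧ IsRationalClass x} = V →
      V.map (A.pullback (2 * p)).hom =
        ⨆ (p' : ℕ) (q' : ℕ) (_ : p' + q' = 2 * p),
          V.map (A.pullback (2 * p)).hom ⊓ A.hodgePQ (2 * p) p' q' →
      A.hodgePQ (2 * p) (2 * p) 0 ≤ V.map (A.pullback (2 * p)).hom →
      algebraicClasses X p ≤ V →
      LinearMap.range (corrAction μ hX hX hab γ) ≤ V) :
    ∀ j, b j ∈ supportedClasses X (2 * p) 1 := by
  intro j
  set δ : complexBetti (X ⊗ X) (2 * (2 * p)) :=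
    complexGysin μ hX (IsSmoothProjective.tensor_holds hX hX) (lift (𝟙 X) (𝟙 X)) hδ
      (singularCohomology.one ℂ (ComplexPoints X)) with hδdef
  -- the decomposition `b j = (δ − t•γ)^*(b j) + t • γ^*(b j)`
  have hid : corrAction μ hX hX hab δ = LinearMap.id := stub_corrDiagonal μ hX (2 * p) hδ hab
  have hdec : b j = corrAction μ hX hX hab (δ - t • γ) (b j) + t • corrAction μ hX hX hab γ (b j) := by
    rw [map_sub, map_smul, LinearMap.sub_apply, LinearMap.smul_apply, hid, LinearMap.id_apply,
      sub_add_cancel]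
  -- the supported part
  have h1 : corrAction μ hX hX hab (δ - t • γ) (b j) ∈ supportedClasses X (2 * p) 1 :=
    stub_corrTail μ hX hX hab hT hT1 hsupp (b j)
  -- the transcendental part: `γ^*` maps `W = span (b j)` into `Algᵖ(X)`
  have h2 : corrAction μ hX hX hab γ (b j) ∈ algebraicClasses X p := by
    set W : Submodule ℂ (complexBetti X (2 * p)) := Submodule.span ℂ (Set.range b) with hWdef
    have hWrat := ofCohTDD_span_isRationalClass_inter_span_eq hb
    obtain ⟨hMrat, hMsub, hM0⟩ := stub_imagePhantom hX A (corrAction μ hX hX hab γ)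
      (stub_corrActionType μ hX A hab hγalg) (stub_corrActionRat μ hX hab hγrat) W hWrat hsub h20
    have hle : W.map (corrAction μ hX hX hab γ) ≤ algebraicClasses X p :=
      stub_isotypicAlg hp hX A (corrAction μ hX hX hab γ) W (W.map (corrAction μ hX hX hab γ))
        hMrat hMsub hM0 le_rfl hrange
    exact hle (Submodule.mem_map_of_mem (Submodule.subset_span ⟨j, rfl⟩))
  rw [hdec]
  refine Submodule.add_mem _ h1 (Submodule.smul_mem _ t ?_)
  exact supportedClasses_mono X (2 * p) hp h2

/-- **STUB `stub_transcendentalOrSupported_of_cohTDD` — the crux `TranscendentalOrSupported` from a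
cohomological transcendental decomposition of the diagonal** (line `Sketch_chow_shadow`, the
assembly). Hypothesis `hTDD` = the skeleton's open stub `stub_cohTDD` verbatim: for every smooth
projective `2p`-fold `X` (`p ≥ 1`) and Hodge model `A`, an orientation family `μ`, a rational
algebraic `γ ∈ H^{4p}((X ⊗ X)(ℂ); ℂ)`, a scalar `t` and a closed `T ⊆ X` of codimension `≥ 1` with
`δ_X − t•γ` dying on `((X ∖ T) × X)(ℂ)` (`δ_X = Δ_* 1`) and `im γ^* ⊆ T(X) + Algᵖ(X)` (spelled: `im γ^*`
lies in every rationally spanned sub-Hodge `V ⊇ H^{2p,0}, Algᵖ(X)`). Conclusion: the route decl, by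
`transcendentalOrSupportedAt_of_cohTDDAt` at each `X`. -/
theorem stub_transcendentalOrSupported_of_cohTDD
    (hTDD : ∀ ⦃p : ℕ⦄ ⦃X : SchemeOver ℂ⦄, 1 ≤ p → ∀ (hX : IsSmoothProjective (2 * p) X)
      (A : HodgeModel (2 * p) X) (hδ : 0 + 2 * (2 * p + 2 * p) = 2 * (2 * p) + 2 * (2 * p))
      (hab : 2 * p + 2 * (2 * p) = 2 * p + 2 * (2 * p)),
      ∃ (μ : OrientationFamily) (γ : complexBetti (X ⊗ X) (2 * (2 * p))) (t : ℂ) (T : Set X.left),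
        IsRationalClass γ ∧ γ ∈ algebraicClasses (X ⊗ X) (2 * p) ∧ IsClosed T ∧
        (∀ z ∈ T, (1 : ℕ∞) ≤ Order.coheight z) ∧
        complexBetti.restrictCompl (X ⊗ X) ((fst X X).left.base ⁻¹' T) (2 * (2 * p))
          (complexGysin μ hX (IsSmoothProjective.tensor_holds hX hX) (lift (𝟙 X) (𝟙 X)) hδ
            (singularCohomology.one ℂ (ComplexPoints X)) - t • γ) = 0 ∧
        (∀ V : Submodule ℂ (complexBetti X (2 * p)),
          Submodule.span ℂ {x : complexBetti X (2 * p) | x ∈ V ∧ IsRationalClass x} = V →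
          V.map (A.pullback (2 * p)).hom =
            ⨆ (p' : ℕ) (q' : ℕ) (_ : p' + q' = 2 * p),
              V.map (A.pullback (2 * p)).hom ⊓ A.hodgePQ (2 * p) p' q' →
          A.hodgePQ (2 * p) (2 * p) 0 ≤ V.map (A.pullback (2 * p)).hom →
          algebraicClasses X p ≤ V →
          LinearMap.range (corrAction μ hX hX hab γ) ≤ V)) :
    Summit.HodgeConjecture.HodgeConjecture.Theses.LinearSystemTorelli.TranscendentalOrSupported := by
  intro p X hp hX A r b hb hsub h20
  obtain ⟨μ, γ, t, T, hγrat, hγalg, hT, hT1, hsupp, hrange⟩ := hTDD hp hX A (by omega) rfl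
  exact transcendentalOrSupportedAt_of_cohTDDAt hp hX A hb hsub h20 μ t hγrat hγalg hT hT1 _ rfl hsupp
    hrange

/-- **The size of the open stub: `CohTDD` also gives the route item `MiddleDivisorSupport`
(stmt-HodgeConjecture-1081, the Hodge-conjecture part: every rational `(p,p)`-class in `H²ᵖ` of a
smooth projective `2p`-fold is supported on a divisor)** — through the crux and the closed glue item
2411 (`linearSystemTorelli_supportedOfTranscendentalOrSupported_proof`). Hence `stub_cohTDD` ∀X is at
least GHC(2p,1) in full; conversely the crux at `X` gives `CohTDD` at `X` granted algebraic splittings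
of `N¹H²ᵖ(X)` by Gysin images (Deligne, Hodge III 8.2.8, and the Hodge conjecture on the products
`D̃ᵢ × X`), so the stub is crux-equivalent modulo the Hodge conjecture (module docstring). -/
theorem middleDivisorSupport_of_cohTDD
    (hTDD : ∀ ⦃p : ℕ⦄ ⦃X : SchemeOver ℂ⦄, 1 ≤ p → ∀ (hX : IsSmoothProjective (2 * p) X)
      (A : HodgeModel (2 * p) X) (hδ : 0 + 2 * (2 * p + 2 * p) = 2 * (2 * p) + 2 * (2 * p))
      (hab : 2 * p + 2 * (2 * p) = 2 * p + 2 * (2 * p)),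
      ∃ (μ : OrientationFamily) (γ : complexBetti (X ⊗ X) (2 * (2 * p))) (t : ℂ) (T : Set X.left),
        IsRationalClass γ ∧ γ ∈ algebraicClasses (X ⊗ X) (2 * p) ∧ IsClosed T ∧
        (∀ z ∈ T, (1 : ℕ∞) ≤ Order.coheight z) ∧
        complexBetti.restrictCompl (X ⊗ X) ((fst X X).left.base ⁻¹' T) (2 * (2 * p))
          (complexGysin μ hX (IsSmoothProjective.tensor_holds hX hX) (lift (𝟙 X) (𝟙 X)) hδ
            (singularCohomology.one ℂ (ComplexPoints X)) - t • γ) = 0 ∧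
        (∀ V : Submodule ℂ (complexBetti X (2 * p)),
          Submodule.span ℂ {x : complexBetti X (2 * p) | x ∈ V ∧ IsRationalClass x} = V →
          V.map (A.pullback (2 * p)).hom =
            ⨆ (p' : ℕ) (q' : ℕ) (_ : p' + q' = 2 * p),
              V.map (A.pullback (2 * p)).hom ⊓ A.hodgePQ (2 * p) p' q' →
          A.hodgePQ (2 * p) (2 * p) 0 ≤ V.map (A.pullback (2 * p)).hom →
          algebraicClasses X p ≤ V →
          LinearMap.range (corrAction μ hX hX hab γ) ≤ V)) :
    Summit.HodgeConjecture.HodgeConjecture.Theses.LinearSystemTorelli.MiddleDivisorSupport :=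
  linearSystemTorelli_supportedOfTranscendentalOrSupported_proof
    (stub_transcendentalOrSupported_of_cohTDD hTDD)

end Summit.HodgeConjecture.HodgeConjecture.Theorems

end
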